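import Summits.BirchSwinnertonDyer.BirchSwinnertonDyer.Theorems.ThetaPartnerAtTwoSignedControlAtTwoRelaxedKummerCountLevelZero
import Mathlib.NumberTheory.RamificationInertia.Basic
import HarnessLib

/-!
# (I1) FROM POITOU–TATE, Side A at ALL layers, part 1: the relaxed Kummer count at a FINITE SET of finite places
# over ANY number field (`∏_{𝔮∈Q} #𝓛_𝔮 ≤ #H¹_{𝓛, ⊤ at Q}(K, E[p^k]) · ∏_{w∣∞} #H¹(K_w, E)`)

Route `ThetaPartnerAtTwo` (TP2) / `ResidualThetaTransportAtTwo` (RTT), PUB conjunction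
`PublishedInputsGreenbergControlAtTwo` (stmt-BirchSwinnertonDyer-24143, conj. 5 via
`…H1SigmaNotTorsionOfRelaxed`) and K4 `SignedControlAtTwo` (stmt-BirchSwinnertonDyer-20309); seat
`bsd-inputs-r1-p1` (D-0154 (2) INPUTS row 1, input (I1) `WeierstrassCurve.relaxedSelmer_torsion_card_growth`
= Greenberg LNM 1716 Thm. 1.7 / p. 62 finite-level count). Sequel of `…RelaxedKummerCount` (Part A: one
place) and `…RelaxedKummerCountLevelZero` (Part B: level `0`). This file is the SIDE-A count needed at
EVERY layer `K_n`: the previous files relax at ONE place `𝔮` and bound `#(𝓞_𝔮/p^k) ≥ p^k`, which over the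
layer `K_n` only gives `p^{k·#{w ∣ v}}`, not `p^{k pⁿ}` (`v ∣ p` ramifies in a `ℤ_p`-tower). Here:

* `prod_natCard_kummerSelmerStructure_le_natCard_kummerOutside` — **`∏_{𝔮 ∈ Q} #𝓛_𝔮 ≤ #H¹_{𝓛, ⊤ at Q and ∞}(K, E[p^k])`**
  for ANY finite set `Q` of finite places of ANY number field `K` (Poitou–Tate counting form for
  `𝓕 = kummerRelaxed ∞ ≤ 𝓖 = kummerRelaxed (Q ∪ ∞)`, Tate's local count `#H¹(K_𝔮, E[p^k]) = (#𝓛_𝔮)²` at each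
  `𝔮 ∈ Q`, inverse Weil transport — verbatim the one-place argument of Part A with products over `Q`);
* `prod_natCard_kummerSelmerStructure_le_natCard_kummerOutside_mul` — the Kummer condition imposed ALSO at the
  archimedean places: `∏_{𝔮 ∈ Q} #𝓛_𝔮 ≤ #H¹_{𝓛, ⊤ at Q}(K, E[p^k]) · ∏_{w∣∞} #H¹(K_w, E)` (constant independent of
  `k`), and `prod_natCard_quot_le_natCard_kummerOutside_mul` (`#𝓛_𝔮 ≥ #(𝓞_𝔮/p^k)`, Milne I 3.3);
(The relative local count `p^{k·[L:F]} ≤ ∏_{w∣v} #(𝓞_{L,w}/p^k)` for `F ⊆ L` and the assembled Side-A count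
`p^{k·[L:F]} ≤ #H¹_{𝓛, ⊤ above v}(L, E_L[p^k]) · C_∞(L)` are the sequel `…RelaxedKummerCountRelative`.)

HONEST FRAMING: THEOREMS ONLY (no definition, no named fact, no `sorry`), CONDITIONAL on the named fact
`poitouTate_selmerStructure_duality` of the field counted over, taken as a hypothesis; Side A of (I1) at all
layers; the transport to the `subgroupH1 (κ.layerSubgroup n)`/`conjH1`/`localKerOver` currency of (I1) is the
sequel `…RelaxedKummerCountAllLevels`. Closes nothing by itself; BSD is not proved by any of this.

References: [cite: GreenbergLNM1716, Thm 1.7 and the paragraph after it (pp. 61–62)] [cite: MilneADT2006, Ch. I,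
Lemma 3.3, Thm. 2.8, Cor. 3.4, Thm. 4.10] [cite: NeukirchSchmidtWingberg2008, (8.7.9)] [cite: NeukirchANT1999, Ch. I (8.2), Ch. II (8.4)].
-/

set_option linter.dupNamespace false

noncomputable section
open scoped Classical
open CategoryTheory Field NumberField IsDedekindDomain Function
open Literature.NumberTheory.EllipticCurves Literature.NumberTheory.EllipticCurves.GreenbergSelmer
open Literature.NumberTheory.GaloisRepresentations
open Literature.NumberTheory.GaloisRepresentations.DiscreteGaloisModule (SelmerStructure tateDual)
open Literature.NumberTheory.GaloisCohomology
open scoped ContRepresentation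
namespace Summit.BirchSwinnertonDyer.BirchSwinnertonDyer.Theorems.SignedEC.RelaxedKummerCount

open Summit.BirchSwinnertonDyer.Rank1Residual.X11b.KummerPT Summit.BirchSwinnertonDyer.Rank1Residual.X11b.LocBridge
  Summit.BirchSwinnertonDyer.Rank1Residual.X11b.Levels Summit.BirchSwinnertonDyer.Rank1Residual.X11b.AcSelmer
  Summit.BirchSwinnertonDyer.Rank1Residual.X11b.SelmerLevelBound

variable {K : Type} [Field K] [NumberField K] (W : WeierstrassCurve K) [W.IsElliptic] (p k : ℕ)
  [Fact p.Prime]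

/-! ## §1 The relaxed Kummer count at a finite set of finite places -/

omit [NumberField K] in
/-- `Sum.inr v` lies in `Q.image Sum.inr ∪ ∞` iff `v ∈ Q`. [folklore] -/
theorem inr_mem_image_inr_union_iff [NumberField K] (Q : Finset (HeightOneSpectrum (𝓞 K)))
    (v : HeightOneSpectrum (𝓞 K)) :
    (Sum.inr v : Place K) ∈ Q.image Sum.inr ∪ Finset.univ.image Sum.inl ↔ v ∈ Q := by
  rw [Finset.mem_union, Finset.mem_image]
  constructor
  · rintro (⟨u, hu, huv⟩ | h)
    · rwa [← Sum.inr_injective huv]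
    · exact absurd h (inr_not_mem_image_inl v)
  · exact fun h ↦ Or.inl ⟨v, h, rfl⟩

omit [NumberField K] in
/-- `Sum.inr v` lies in `Q.image Sum.inr` iff `v ∈ Q`. [folklore] -/
theorem inr_mem_image_inr_iff [NumberField K] (Q : Finset (HeightOneSpectrum (𝓞 K)))
    (v : HeightOneSpectrum (𝓞 K)) :
    (Sum.inr v : Place K) ∈ (Q.image Sum.inr : Finset (Place K)) ↔ v ∈ Q := by
  rw [Finset.mem_image]
  constructor
  · rintro ⟨u, hu, huv⟩
    rwa [← Sum.inr_injective huv]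
  · exact fun h ↦ ⟨v, h, rfl⟩

omit [NumberField K] in
/-- No infinite place lies in `Q.image Sum.inr`. [folklore] -/
theorem inl_not_mem_image_inr [NumberField K] (Q : Finset (HeightOneSpectrum (𝓞 K))) (w : InfinitePlace K) :
    (Sum.inl w : Place K) ∉ (Q.image Sum.inr : Finset (Place K)) := by
  intro h
  obtain ⟨u, -, hu⟩ := Finset.mem_image.mp h
  exact Sum.inr_ne_inl hu

/-- **THE RELAXED KUMMER COUNT AT A FINITE SET OF PLACES: `∏_{𝔮 ∈ Q} #𝓛_𝔮 ≤ #H¹_{𝓛, ⊤ at Q and ∞}(K, E[p^k])`**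
for `E = W` elliptic over a number field `K` (real places allowed), a prime `p`, `k ≥ 1` and ANY finite set
`Q` of finite places, GIVEN Poitou–Tate for Selmer structures. Milne I Thm. 4.10 counting form for
`𝓕 = kummerRelaxed ∞ ≤ 𝓖 = kummerRelaxed (Q ∪ ∞)`: `#(H¹_𝓖/H¹_𝓕)·#(H¹_{𝓕*}/H¹_{𝓖*})·∏_{v} #𝓕_v = ∏_{v} #𝓖_v`,
the products agreeing off `Q` and `#𝓖_𝔮 = #H¹(K_𝔮, E[p^k]) = (#𝓛_𝔮)²` at `𝔮 ∈ Q` (Tate), so the two indices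
multiply to `∏_Q #𝓛_𝔮`, and `#(H¹_{𝓕*}/H¹_{𝓖*}) ≤ #H¹_{𝓕*} ≤ #H¹_𝓕` (inverse Weil transport). Part A of the cell is
the case `Q = {𝔮}`. [cite: MilneADT2006, Ch. I, Thm. 4.10, Thm. 2.8, Cor. 3.4]
[cite: Howard2004HeegnerKolyvagin, Thm. 2.1.11 (arXiv:1202.6340 p. 6)] [cite: PoonenRains2012, Prop. 4.10] -/
theorem prod_natCard_kummerSelmerStructure_le_natCard_kummerOutside (hk : 0 < k)
    (hPT : poitouTate_selmerStructure_duality K) (Q : Finset (HeightOneSpectrum (𝓞 K))) :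
    ∏ 𝔮 ∈ Q, Nat.card (W.kummerSelmerStructure ((p ^ k : ℕ) : ℤ) (Sum.inr 𝔮)) ≤
      Nat.card (kummerOutside W (p ^ k) (Q.image Sum.inr ∪ Finset.univ.image Sum.inl)) := by
  classical
  have hprime : p.Prime := Fact.out
  haveI : NeZero (p ^ k) := ⟨pow_ne_zero k hprime.ne_zero⟩
  haveI : Finite (W.geomTorsion ((p ^ k : ℕ) : ℤ)) := finite_geomTorsion_of_neZero W _
  haveI : CompactSpace (absoluteGaloisGroup K) := absoluteGaloisGroup_compactSpace K
  have hpp : IsPrimePow (p ^ k) := ⟨p, k, hprime.prime, hk, rfl⟩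
  have hp2 : 2 ≤ p ^ k := le_trans hprime.two_le (Nat.le_self_pow hk.ne' p)
  have hchar : ((p ^ k : ℕ) : K) ≠ 0 := Nat.cast_ne_zero.mpr (pow_ne_zero _ hprime.ne_zero)
  obtain ⟨e, hμ, hadd₁, hadd₂, halt, hnondeg, hgal⟩ := W.exists_weilPairing_holds (p ^ k) hp2 hchar
  obtain ⟨inv, hperf, hsum, -, hcompl⟩ := hPT (p ^ k)
  have hEuler : ∀ v : HeightOneSpectrum (𝓞 K),
      Nat.card (galoisCohomology ((W.torsionGaloisModule ((p ^ k : ℕ) : ℤ)).toLocal (Sum.inr v)) 1) =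
        (Nat.card (nsmulAddMonoidHom (p ^ k) :
            (W.baseChange (v.adicCompletion K)).toAffine.Point →+ _).ker *
          Nat.card (v.adicCompletionIntegers K ⧸
            Ideal.span {((p ^ k : ℕ) : v.adicCompletionIntegers K)})) ^ 2 := fun v ↦
    natCard_galoisCohomology_one_torsion_adicCompletion_eq_sqEP W v (p ^ k) hpp
  -- the two relaxed structures
  set R : Finset (Place K) := Finset.univ.image Sum.inl with hR
  set S' : Finset (Place K) := Q.image Sum.inr ∪ R with hS'
  set ρ := W.torsionGaloisModule ((p ^ k : ℕ) : ℤ) with hρ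
  set 𝓕 : SelmerStructure ρ := kummerRelaxed W (p ^ k) R with h𝓕def
  set 𝓖 : SelmerStructure ρ := kummerRelaxed W (p ^ k) S' with h𝓖def
  have hRS' : R ⊆ S' := Finset.subset_union_right
  have hle : 𝓕 ≤ 𝓖 := by
    intro v
    by_cases hv : v ∈ R
    · rw [h𝓕def, h𝓖def, kummerRelaxed_of_mem W (p ^ k) R hv, kummerRelaxed_of_mem W (p ^ k) S' (hRS' hv)]
    · rw [h𝓕def, kummerRelaxed_of_not_mem W (p ^ k) R hv]
      by_cases hv' : v ∈ S'
      · rw [h𝓖def, kummerRelaxed_of_mem W (p ^ k) S' hv']; exact le_top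
      · rw [h𝓖def, kummerRelaxed_of_not_mem W (p ^ k) S' hv']
  -- exceptional set
  obtain ⟨T, hS'T, hinf, hp, hbad⟩ := exists_exceptional_finset W p S'
  have hMn : ∀ m : W.geomTorsion ((p ^ k : ℕ) : ℤ), (p ^ k) • m = 0 := fun m ↦
    AddSubgroup.torsionBy.nsmul m
  have hTout : ∀ v : HeightOneSpectrum (𝓞 K), (Sum.inr v : Place K) ∉ T →
      ((p ^ k : ℕ) : 𝓞 K) ∉ v.asIdeal ∧
        GaloisRep.IsUnramifiedAt v (W.torsionGaloisModule ((p ^ k : ℕ) : ℤ)) := by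
    intro v hv
    have hpv : ((p : ℕ) : 𝓞 K) ∉ v.asIdeal := fun h ↦ hv (hp v h)
    have hgood : W.HasGoodReductionAt v := by
      by_contra hbad'
      exact hv (hbad v hbad')
    exact ⟨natCast_pow_not_mem p hpv _,
      isUnramifiedAt_torsionGaloisModule W hgood (intCast_pow_not_mem p hpv _)⟩
  have h𝓕 : 𝓕.IsUnramifiedOutside T :=
    kummerRelaxed_isUnramifiedOutside W p k R T (hRS'.trans hS'T) hinf hp hbad
  have h𝓖 : 𝓖.IsUnramifiedOutside T :=
    kummerRelaxed_isUnramifiedOutside W p k S' T hS'T hinf hp hbad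
  have hinfeq : ∀ w : InfinitePlace K, 𝓕 (Sum.inl w) = 𝓖 (Sum.inl w) := fun w ↦ by
    rw [h𝓕def, h𝓖def, kummerRelaxed_of_mem W (p ^ k) R (inl_mem_image_inl w),
      kummerRelaxed_of_mem W (p ^ k) S' (hRS' (inl_mem_image_inl w))]
  set Sf : Finset (HeightOneSpectrum (𝓞 K)) := T.preimage Sum.inr (Sum.inr_injective.injOn) with hSf
  have hSfmem : ∀ v, v ∈ Sf ↔ (Sum.inr v : Place K) ∈ T := fun v ↦ by
    rw [hSf, Finset.mem_preimage]
  -- Poitou–Tate, counting form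
  have key := natCard_selmerQuotient_mul_of_poitouTate hperf hsum hcompl ρ hMn T hTout hle h𝓕 h𝓖 hinfeq Sf
    hSfmem
  -- abbreviations
  set L : HeightOneSpectrum (𝓞 K) → ℕ := fun 𝔮 ↦
    Nat.card (W.kummerSelmerStructure ((p ^ k : ℕ) : ℤ) (Sum.inr 𝔮)) with hL
  have hQS' : ∀ 𝔮 ∈ Q, (Sum.inr 𝔮 : Place K) ∈ S' := fun 𝔮 h𝔮 ↦
    (inr_mem_image_inr_union_iff Q 𝔮).mpr h𝔮
  have hQSf : Q ⊆ Sf := fun 𝔮 h𝔮 ↦ (hSfmem 𝔮).mpr (hS'T (hQS' 𝔮 h𝔮))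
  have h𝓕Q : ∀ 𝔮 ∈ Q, Nat.card (𝓕 (Sum.inr 𝔮)) = L 𝔮 := fun 𝔮 _ ↦ by
    rw [h𝓕def, kummerRelaxed_of_not_mem W (p ^ k) R (inr_not_mem_image_inl 𝔮)]
  have h𝓖Q : ∀ 𝔮 ∈ Q, 𝓖 (Sum.inr 𝔮) = ⊤ := fun 𝔮 h𝔮 ↦ by
    rw [h𝓖def, kummerRelaxed_of_mem W (p ^ k) S' (hQS' 𝔮 h𝔮)]
  have hoff : ∀ v ∈ Sf \ Q, 𝓕 (Sum.inr v) = 𝓖 (Sum.inr v) := by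
    intro v hv
    have hvQ : v ∉ Q := (Finset.mem_sdiff.mp hv).2
    have hvS' : (Sum.inr v : Place K) ∉ S' := fun h ↦ hvQ ((inr_mem_image_inr_union_iff Q v).mp h)
    rw [h𝓕def, h𝓖def, kummerRelaxed_of_not_mem W (p ^ k) R (inr_not_mem_image_inl v),
      kummerRelaxed_of_not_mem W (p ^ k) S' hvS']
  -- local finiteness and the local count on `Q`
  haveI hfinloc : ∀ v : HeightOneSpectrum (𝓞 K),
      Finite (galoisCohomology (ρ.toLocal (Sum.inr v)) 1) := fun v ↦
    finite_galoisCohomology_toLocal_inr W (p ^ k) v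
  have hLcard : ∀ 𝔮, L 𝔮 = Nat.card (nsmulAddMonoidHom (p ^ k) :
        (W.baseChange (𝔮.adicCompletion K)).toAffine.Point →+ _).ker *
      Nat.card (𝔮.adicCompletionIntegers K ⧸ Ideal.span {((p ^ k : ℕ) : 𝔮.adicCompletionIntegers K)}) :=
    fun 𝔮 ↦ W.natCard_kummerSelmerStructure_inr 𝔮 (NeZero.ne (p ^ k))
  have htop : ∀ 𝔮 ∈ Q, Nat.card (𝓖 (Sum.inr 𝔮)) = L 𝔮 * L 𝔮 := fun 𝔮 h𝔮 ↦ by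
    rw [h𝓖Q 𝔮 h𝔮, AddSubgroup.card_top, hEuler 𝔮, hLcard, sq]
  have hLpos : ∀ 𝔮, 0 < L 𝔮 := fun 𝔮 ↦ Nat.card_pos
  have hprodLpos : 0 < ∏ 𝔮 ∈ Q, L 𝔮 := Finset.prod_pos fun 𝔮 _ ↦ hLpos 𝔮
  -- split the products along `Q ⊆ Sf`
  set P := ∏ v ∈ Sf \ Q, Nat.card (𝓕 (Sum.inr v)) with hP
  have hPpos : 0 < P := Finset.prod_pos fun v _ ↦ Nat.card_pos
  have hprodF : ∏ v ∈ Sf, Nat.card (𝓕 (Sum.inr v)) = P * ∏ 𝔮 ∈ Q, L 𝔮 := by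
    rw [← Finset.prod_sdiff hQSf, Finset.prod_congr rfl h𝓕Q]
  have hPeq : ∏ v ∈ Sf \ Q, Nat.card (𝓖 (Sum.inr v)) = P :=
    Finset.prod_congr rfl fun v hv ↦ by rw [hoff v hv]
  have hprodG : ∏ v ∈ Sf, Nat.card (𝓖 (Sum.inr v)) = P * ((∏ 𝔮 ∈ Q, L 𝔮) * ∏ 𝔮 ∈ Q, L 𝔮) := by
    rw [← Finset.prod_sdiff hQSf, hPeq, Finset.prod_congr rfl htop, Finset.prod_mul_distrib]
  -- the two indices
  set a := Nat.card (𝓖.selmerGroup ⧸ (𝓕.selmerGroup).addSubgroupOf 𝓖.selmerGroup) with ha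
  set b := Nat.card ((inv.dualSelmerStructure ρ 𝓕).selmerGroup ⧸
    ((inv.dualSelmerStructure ρ 𝓖).selmerGroup).addSubgroupOf (inv.dualSelmerStructure ρ 𝓕).selmerGroup) with hb
  have hab : a * b = ∏ 𝔮 ∈ Q, L 𝔮 := by
    rw [hprodF, hprodG] at key
    have key' : a * b * (P * ∏ 𝔮 ∈ Q, L 𝔮) = (∏ 𝔮 ∈ Q, L 𝔮) * (P * ∏ 𝔮 ∈ Q, L 𝔮) := by rw [key]; ring
    exact Nat.eq_of_mul_eq_mul_right (Nat.mul_pos hPpos hprodLpos) key'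
  -- finiteness of the Selmer groups
  haveI hfinG : Finite 𝓖.selmerGroup := by
    rw [h𝓖def, selmerGroup_kummerRelaxed]; exact finite_kummerOutside W (p ^ k) S'
  haveI hfinF : Finite 𝓕.selmerGroup := by
    rw [h𝓕def, selmerGroup_kummerRelaxed]; exact finite_kummerOutside W (p ^ k) R
  -- the dual Selmer group of `𝓕` injects into the Selmer group of `𝓕` by the inverse Weil transport
  have hto : ∀ y ∈ (inv.dualSelmerStructure ρ 𝓕).selmerGroup,
      galoisCohomology.map (weilDualInv W (p ^ k) e hμ hadd₁ hadd₂ hgal hnondeg) 1 y ∈ 𝓕.selmerGroup := by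
    intro y hy
    rw [SelmerStructure.mem_selmerGroup_iff] at hy ⊢
    intro v
    rw [show galoisCohomology.localization ρ v 1
        (galoisCohomology.map (weilDualInv W (p ^ k) e hμ hadd₁ hadd₂ hgal hnondeg) 1 y) =
        galoisCohomology.map ((weilDualInv W (p ^ k) e hμ hadd₁ hadd₂ hgal hnondeg).restrictField
          (Place.Completion v)) 1 (galoisCohomology.localization (ρ.tateDual (p ^ k)) v 1 y) from
      galoisCohomology.res_map_one (Place.Completion v) (weilDualInv W (p ^ k) e hμ hadd₁ hadd₂ hgal hnondeg) y]
    cases v with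
    | inl w =>
      rw [h𝓕def, kummerRelaxed_of_mem W (p ^ k) R (inl_mem_image_inl w)]
      exact AddSubgroup.mem_top _
    | inr v =>
      have hyv := hy (Sum.inr v)
      rw [LocalInvariants.dualSelmerStructure_apply, h𝓕def,
        kummerRelaxed_of_not_mem W (p ^ k) R (inr_not_mem_image_inl v)] at hyv
      rw [h𝓕def, kummerRelaxed_of_not_mem W (p ^ k) R (inr_not_mem_image_inl v)]
      exact map_weilDualInv_mem_kummer_of_mem_dualLocalCondition W (p ^ k) e hμ hadd₁ hadd₂ hgal halt
        hnondeg inv v (hperf v).1.1 (hEuler v) hyv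
  set φ : (inv.dualSelmerStructure ρ 𝓕).selmerGroup → 𝓕.selmerGroup := fun y ↦
    ⟨galoisCohomology.map (weilDualInv W (p ^ k) e hμ hadd₁ hadd₂ hgal hnondeg) 1 y.1, hto y.1 y.2⟩ with hφ
  have hφinj : Injective φ := by
    intro y y' h
    apply Subtype.ext
    have h1 := congrArg Subtype.val h
    exact map_injective_of_comp_eq _ _
      (weilDualIntertwining_weilDualInv W (p ^ k) e hμ hadd₁ hadd₂ hgal hnondeg) h1
  haveI hfinFd : Finite (inv.dualSelmerStructure ρ 𝓕).selmerGroup := Finite.of_injective φ hφinj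
  have hb_le : b ≤ Nat.card 𝓕.selmerGroup :=
    (Nat.card_le_card_of_surjective _ (QuotientAddGroup.mk_surjective)).trans
      (Nat.card_le_card_of_injective φ hφinj)
  -- Lagrange in `H¹_𝓖`
  have hFG : 𝓕.selmerGroup ≤ 𝓖.selmerGroup := by
    intro x hx
    rw [SelmerStructure.mem_selmerGroup_iff] at hx ⊢
    exact fun v ↦ hle v (hx v)
  have hlag : Nat.card 𝓖.selmerGroup = a * Nat.card 𝓕.selmerGroup := by
    rw [ha, AddSubgroup.card_eq_card_quotient_mul_card_addSubgroup ((𝓕.selmerGroup).addSubgroupOf 𝓖.selmerGroup),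
      Nat.card_congr (AddSubgroup.addSubgroupOfEquivOfLe hFG).toEquiv]
  -- assemble
  rw [← selmerGroup_kummerRelaxed W (p ^ k) S']
  change ∏ 𝔮 ∈ Q, L 𝔮 ≤ Nat.card 𝓖.selmerGroup
  calc ∏ 𝔮 ∈ Q, L 𝔮 = a * b := hab.symm
    _ ≤ a * Nat.card 𝓕.selmerGroup := Nat.mul_le_mul_left a hb_le
    _ = Nat.card 𝓖.selmerGroup := hlag.symm

/-! ## §2 Imposing the Kummer condition at the archimedean places (a constant independent of `k`) -/

/-- **`∏_{𝔮∈Q} #𝓛_𝔮 ≤ #H¹_{𝓛, ⊤ at Q}(K, E[p^k]) · ∏_{w ∣ ∞} #H¹(K_w, E(K̄_w))`**: the classes of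
`H¹_{𝓛, ⊤ at Q and ∞}` killed by the (finitely many, finite) archimedean Kummer defects
`H¹(K, E[p^k]) → H¹(K_w, E)` form `H¹_{𝓛, ⊤ at Q} = kummerOutside W (p^k) Q`; each `H¹(K_w, E)` is finite
(tree `H1SigmaCorank.finite_localH1_infinitePlace`), so the correction is independent of `k`. Level-`0`
file, first theorem, with `{𝔮}` replaced by `Q`. [cite: MilneADT2006, Ch. I, Lemma 3.3, Rem. 3.7 and Thm. 4.10]
[cite: GreenbergLNM1716, §4 pp. 105–106] -/
theorem prod_natCard_kummerSelmerStructure_le_natCard_kummerOutside_mul (hk : 0 < k)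
    (hPT : poitouTate_selmerStructure_duality K) (Q : Finset (HeightOneSpectrum (𝓞 K))) :
    ∏ 𝔮 ∈ Q, Nat.card (W.kummerSelmerStructure ((p ^ k : ℕ) : ℤ) (Sum.inr 𝔮)) ≤
      Nat.card (kummerOutside W (p ^ k) (Q.image Sum.inr)) *
        ∏ w : InfinitePlace K, Nat.card (galoisCohomology (W.localGaloisModule w.Completion) 1) := by
  classical
  haveI : NeZero (p ^ k) := ⟨pow_ne_zero k (Fact.out : p.Prime).ne_zero⟩
  haveI : Finite (W.geomTorsion ((p ^ k : ℕ) : ℤ)) := finite_geomTorsion_of_neZero W _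
  set S' : Finset (Place K) := Q.image Sum.inr ∪ Finset.univ.image Sum.inl with hS'
  set A := kummerOutside W (p ^ k) S' with hA
  haveI : Finite A := finite_kummerOutside W (p ^ k) S'
  haveI hfinw : ∀ w : InfinitePlace K, Finite (galoisCohomology (W.localGaloisModule w.Completion) 1) :=
    fun w ↦ H1SigmaCorank.finite_localH1_infinitePlace W w
  -- the archimedean "Kummer defect" map
  let g : ∀ w : InfinitePlace K, galoisCohomology (W.torsionGaloisModule ((p ^ k : ℕ) : ℤ)) 1 →+
      galoisCohomology (W.localGaloisModule w.Completion) 1 := fun w ↦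
    (galoisCohomology.map (W.torsionPointsMapIntertwining ((p ^ k : ℕ) : ℤ) w.Completion) 1).comp
      (galoisCohomology.localization (W.torsionGaloisModule ((p ^ k : ℕ) : ℤ)) (Sum.inl w) 1)
  let f : A →+ ∀ w : InfinitePlace K, galoisCohomology (W.localGaloisModule w.Completion) 1 :=
    (AddMonoidHom.pi g).comp A.subtype
  have hf : ∀ (x : A) (w : InfinitePlace K), f x w =
      galoisCohomology.map (W.torsionPointsMapIntertwining ((p ^ k : ℕ) : ℤ) w.Completion) 1
        (galoisCohomology.localization (W.torsionGaloisModule ((p ^ k : ℕ) : ℤ)) (Sum.inl w) 1 x.1) :=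
    fun _ _ ↦ rfl
  -- its kernel lies in `kummerOutside W (p^k) Q`
  have hker : ∀ x : f.ker, (x.1.1 : galoisCohomology (W.torsionGaloisModule ((p ^ k : ℕ) : ℤ)) 1) ∈
      kummerOutside W (p ^ k) (Q.image Sum.inr) := by
    intro x
    have hx0 : f x.1 = 0 := (AddMonoidHom.mem_ker).mp x.2
    have hxA := (mem_kummerOutside_iff W (p ^ k) S' x.1.1).mp x.1.2
    rw [mem_kummerOutside_iff]
    intro v hv
    cases v with
    | inl w =>
      have h0 : f x.1 w = 0 := by rw [hx0]; rfl
      rw [hf] at h0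
      exact h0
    | inr v =>
      exact hxA (Sum.inr v) (by
        rw [hS', Finset.mem_union, not_or]
        exact ⟨hv, inr_not_mem_image_inl v⟩)
  let ι : f.ker → kummerOutside W (p ^ k) (Q.image Sum.inr) := fun x ↦ ⟨x.1.1, hker x⟩
  have hι : Injective ι := fun x y h ↦ by
    have h1 : (ι x).1 = (ι y).1 := congrArg Subtype.val h
    exact Subtype.ext (Subtype.ext h1)
  haveI : Finite (kummerOutside W (p ^ k) (Q.image Sum.inr)) := finite_kummerOutside W (p ^ k) _
  haveI : Finite f.ker := Finite.of_injective ι hι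
  calc ∏ 𝔮 ∈ Q, Nat.card (W.kummerSelmerStructure ((p ^ k : ℕ) : ℤ) (Sum.inr 𝔮))
      ≤ Nat.card A := prod_natCard_kummerSelmerStructure_le_natCard_kummerOutside W p k hk hPT Q
    _ ≤ Nat.card f.ker * Nat.card (∀ w : InfinitePlace K, galoisCohomology (W.localGaloisModule w.Completion) 1) :=
        natCard_le_natCard_ker_mul f
    _ ≤ Nat.card (kummerOutside W (p ^ k) (Q.image Sum.inr)) *
        ∏ w : InfinitePlace K, Nat.card (galoisCohomology (W.localGaloisModule w.Completion) 1) := by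
        rw [Nat.card_pi]
        exact Nat.mul_le_mul_right _ (Nat.card_le_card_of_injective ι hι)

/-- **`∏_{𝔮∈Q} #(𝓞_𝔮/p^k) ≤ #H¹_{𝓛, ⊤ at Q}(K, E[p^k]) · ∏_{w∣∞} #H¹(K_w, E)`** (all `k`, also `k = 0`): the
previous count with `#𝓛_𝔮 = #E(K_𝔮)[p^k] · #(𝓞_𝔮/p^k) ≥ #(𝓞_𝔮/p^k)` (Milne I Lemma 3.3, tree
`natCard_kummerSelmerStructure_inr`). [cite: MilneADT2006, Ch. I, Lemma 3.3 and Thm. 4.10] -/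
theorem prod_natCard_quot_le_natCard_kummerOutside_mul (hPT : poitouTate_selmerStructure_duality K)
    (Q : Finset (HeightOneSpectrum (𝓞 K))) (k : ℕ) :
    ∏ 𝔮 ∈ Q, Nat.card (𝔮.adicCompletionIntegers K ⧸ Ideal.span {((p ^ k : ℕ) : 𝔮.adicCompletionIntegers K)}) ≤
      Nat.card (kummerOutside W (p ^ k) (Q.image Sum.inr)) *
        ∏ w : InfinitePlace K, Nat.card (galoisCohomology (W.localGaloisModule w.Completion) 1) := by
  classical
  have hprime : p.Prime := Fact.out
  haveI hfinw : ∀ w : InfinitePlace K, Finite (galoisCohomology (W.localGaloisModule w.Completion) 1) :=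
    fun w ↦ H1SigmaCorank.finite_localH1_infinitePlace W w
  have hprod : 0 < ∏ w : InfinitePlace K, Nat.card (galoisCohomology (W.localGaloisModule w.Completion) 1) :=
    Finset.prod_pos fun w _ ↦ Nat.card_pos
  rcases Nat.eq_zero_or_pos k with rfl | hk
  · haveI : Finite (W.geomTorsion ((p ^ 0 : ℕ) : ℤ)) := finite_geomTorsion_of_neZero W _
    haveI := finite_kummerOutside W (p ^ 0) (Q.image Sum.inr : Finset (Place K))
    have h1 : ∀ 𝔮 ∈ Q, Nat.card (𝔮.adicCompletionIntegers K ⧸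
        Ideal.span {((p ^ 0 : ℕ) : 𝔮.adicCompletionIntegers K)}) ≤ 1 := fun 𝔮 _ ↦ by
      rw [pow_zero, Nat.cast_one, Ideal.span_singleton_one]
      haveI : Subsingleton (𝔮.adicCompletionIntegers K ⧸ (⊤ : Ideal (𝔮.adicCompletionIntegers K))) :=
        Ideal.Quotient.subsingleton_iff.mpr rfl
      exact (Nat.card_of_subsingleton (0 : 𝔮.adicCompletionIntegers K ⧸ (⊤ : Ideal _))).le
    calc ∏ 𝔮 ∈ Q, Nat.card (𝔮.adicCompletionIntegers K ⧸
          Ideal.span {((p ^ 0 : ℕ) : 𝔮.adicCompletionIntegers K)}) ≤ ∏ 𝔮 ∈ Q, 1 :=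
          Finset.prod_le_prod (fun _ _ ↦ Nat.zero_le _) h1
      _ = 1 := Finset.prod_const_one
      _ ≤ _ := Nat.mul_pos Nat.card_pos hprod
  calc ∏ 𝔮 ∈ Q, Nat.card (𝔮.adicCompletionIntegers K ⧸ Ideal.span {((p ^ k : ℕ) : 𝔮.adicCompletionIntegers K)})
      ≤ ∏ 𝔮 ∈ Q, Nat.card (W.kummerSelmerStructure ((p ^ k : ℕ) : ℤ) (Sum.inr 𝔮)) := by
        refine Finset.prod_le_prod (fun _ _ ↦ Nat.zero_le _) fun 𝔮 _ ↦ ?_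
        rw [W.natCard_kummerSelmerStructure_inr 𝔮 (pow_ne_zero k hprime.ne_zero)]
        haveI := W.finite_ker_nsmul_adicCompletion 𝔮 (pow_ne_zero k hprime.ne_zero)
        exact Nat.le_mul_of_pos_left _ Nat.card_pos
    _ ≤ _ := prod_natCard_kummerSelmerStructure_le_natCard_kummerOutside_mul W p k hk hPT Q



end Summit.BirchSwinnertonDyer.BirchSwinnertonDyer.Theorems.SignedEC.RelaxedKummerCount

end
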